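import Literature.Topology.FourManifolds.OneHandleStepMatch
import Literature.Topology.FourManifolds.MorseChartReflect
import HarnessLib

/-!
# The handle-extension step for one `1`-handle: construction of the context

Topic `Literature/Topology/FourManifolds` (fact seat
`provefact-Literature.Topology.FourManifolds.IsHandlebody.exists_diffeomorph_isBoundaryGluing_sphere`,
step F2b₁ of the Lickorish–Wallace DAG).  Everything here is **proved**; no named facts.  This
file **constructs the context** `OneHandleStepContext` from the data of the level step
(`levelStepData`): handle sides on both manifolds (`exists_handleSide_data`,
`HandleSideConstruction.lean`), the field of `M` pulled back from the field of `M'` on the seed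
collar (abstract pull-back hypothesis `hpull`), all the constants, and the feet formulas of the
two handle charts (`LevelStepData.hfoot`, `hfoot'`) used by the decision in
`OneHandleStepExists.lean`.

## References

* J. Milnor, *Lectures on the h-cobordism theorem* (1965), Thm. 3.13. [MilnorHCobordism1965]
* A. A. Kosinski, *Differential Manifolds* (1993), VI (6.4), (6.6), (7.1). [Kosinski1993]
* W. B. R. Lickorish, *A representation of orientable combinatorial 3-manifolds*, Ann. of
  Math. 76 (1962), 531–540, p. 538. [LickorishAnnals1962]
-/

open scoped Manifold ContDiff Topology
open Set Function Filter Metric Module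

noncomputable section

namespace Literature.Topology.FourManifolds

universe u

/-- Local notation: `𝔼 n` is the model Euclidean space `EuclideanSpace ℝ (Fin n)`. -/
local notation "𝔼 " n:arg => EuclideanSpace ℝ (Fin n)
/-- Local notation: `ℍ n` is the model half-space `EuclideanHalfSpace n`. -/
local notation "ℍ " n:arg => EuclideanHalfSpace n

/-! ### Field-free gadgets -/


namespace HandleChart.TransferData

variable {n : ℕ} {M : Type u} [TopologicalSpace M] [ChartedSpace (ℍ (n + 1)) M] [IsManifold (𝓡∂ (n + 1)) ∞ M]
  {f : M → ℝ} {X : Π x : M, TangentSpace (𝓡∂ (n + 1)) x} {p : M} {D : HandleChart (𝓡∂ (n + 1)) f X p} {R m : ℝ}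
  [csW : ChartedSpace (ℍ (n + 1)) ↥(f ⁻¹' Iic (f p - m))] [mfdW : IsManifold (𝓡∂ (n + 1)) ∞ ↥(f ⁻¹' Iic (f p - m))]
  (T : D.TransferData R m)

/-- The lifted feet have open range (general transfer data). [folklore] -/
theorem isOpen_range_footLift_gen {ρ : ℝ} (hρ : 0 < ρ) (hmR : m + 2 * ρ ^ 2 ≤ R ^ 2) {s : ℝ} (hs : s ^ 2 = 1) :
    IsOpen (range (T.footLift hρ hmR hs)) := by
  have h := isSmoothEmbedding_levelLift T.hcs T.hn (D.contMDiff_foot T.hm T.hR hmR T.hball hs hρ)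
    (T.apply_foot hρ hmR hs) D.isOpen_footDomain (D.range_foot hs T.hm hρ T.hR hmR T.hball T.hk) (D.contMDiffOn_footInv hρ)
    (D.footInv_foot hs T.hm hρ T.hR hmR T.hball)
  unfold HandleChart.TransferData.footLift; rw [h.2.1]; exact h.2.2

omit mfdW in
/-- **Lifted feet of two handle charts with the same feet coincide.** [folklore] -/
theorem footLift_eq_of_foot_eq {X' : Π x : M, TangentSpace (𝓡∂ (n + 1)) x} {D' : HandleChart (𝓡∂ (n + 1)) f X' p} {R' : ℝ}
    (T' : D'.TransferData R' m) {ρ : ℝ} (hρ : 0 < ρ) (hmR : m + 2 * ρ ^ 2 ≤ R ^ 2) (hmR' : m + 2 * ρ ^ 2 ≤ R' ^ 2)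
    {s s' : ℝ} (hs : s ^ 2 = 1) (hs' : s' ^ 2 = 1) (h : ∀ w, D.foot s m ρ w = D'.foot s' m ρ w) :
    T.footLift hρ hmR hs = T'.footLift hρ hmR' hs' := by
  funext w; apply Subtype.ext; apply Subtype.ext; exact h w

end HandleChart.TransferData

/-- Propositional bookkeeping. [folklore] -/
theorem iff_not_right_of_not_iff' {S A B : Prop} (h : ¬ (S ↔ (A ↔ B))) : (S ↔ (A ↔ ¬ B)) := by tauto

/-! ### Field-free statements of the decision data -/

section Statements

variable {n : ℕ} {M : Type u} [TopologicalSpace M] [ChartedSpace (ℍ (n + 1)) M] [IsManifold (𝓡∂ (n + 1)) ∞ M]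
  {M' : Type u} [TopologicalSpace M'] [ChartedSpace (ℍ (n + 1)) M'] [IsManifold (𝓡∂ (n + 1)) ∞ M']

/-- **The trivial unit-speed slab of a function bounded by `1`**: zero field, identity flow,
empty slab `f⁻¹(2, 3)` — a field-free carrier of the level types and of the canonical level
orientations. [folklore] -/
@[reducible] def rawSlab {f : M → ℝ} (hf : ContMDiff (𝓡∂ (n + 1)) 𝓘(ℝ, ℝ) ∞ f) (hle : ∀ x, f x ≤ 1) : UnitSlab (n := n) M where
  f := f
  X := fun _ => 0
  θ := fun q => q.2
  hf := hf
  flow :=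
    { contMDiff := contMDiff_snd
      map_zero := fun _ => rfl
      map_add := fun _ _ _ => rfl
      isMIntegralCurve := fun p t => by
        have h := hasMFDerivAt_const (I := 𝓘(ℝ, ℝ)) (I' := 𝓡∂ (n + 1)) p t
        have e : ((1 : ℝ →L[ℝ] ℝ).smulRight ((fun _ => (0 : TangentSpace (𝓡∂ (n + 1)) p)) p) : ℝ →L[ℝ] TangentSpace (𝓡∂ (n + 1)) p) = 0 := by
          ext; simp
        rw [e]; exact h }
  lo := 2
  hi := 3
  lo_lt_hi := by norm_num
  unit x hx := absurd hx.1 (by linarith [hle x])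

omit [IsManifold (𝓡∂ (n + 1)) ∞ M] in
/-- Sublevel sets below `1` of an adapted Morse function are interior. [cite: MilnorHCobordism1965, Def. 3.1] -/
theorem IsMorseAdapted.isInteriorPoint_of_le_lt_one {f : M → ℝ} (hf : IsMorseAdapted (𝓡∂ (n + 1)) f) {ℓ : ℝ} (hℓ : ℓ < 1) :
    ∀ x, f x ≤ ℓ → (𝓡∂ (n + 1)).IsInteriorPoint x := fun x hx =>
  ((𝓡∂ (n + 1)).isInteriorPoint_or_isBoundaryPoint x).resolve_right fun hbd => by
    have := (hf.2.1 x hbd).1; linarith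

omit [IsManifold (𝓡∂ (n + 1)) ∞ M] in
/-- A level avoiding the value of the distinguished point and above the threshold is regular. [folklore] -/
theorem not_isMCriticalPt_of_level {f : M → ℝ} {p : M} {θ h ℓ : ℝ}
    (hreg : ∀ x, θ ≤ f x → x ≠ p → ¬ IsMCriticalPt (𝓡∂ (n + 1)) f x) (hfp : f p = h) (h1 : θ ≤ ℓ) (h2 : ℓ ≠ h) :
    ∀ x, f x = ℓ → ¬ IsMCriticalPt (𝓡∂ (n + 1)) f x := fun x hx =>
  hreg x (by rw [hx]; exact h1) (fun hxp => h2 (by rw [← hx, hxp, hfp]))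

/-- **The seed level map preserves the canonical level orientations** — stated on field-free
data (trivial slabs, the level map of the mutually inverse seed maps `g₀`, `g₀'` at the levels
`b - τ₀/2`, `b - τ₀/2 + σ`). [cite: HirschDT1976, §4.4 p. 101] -/
structure SeedStatement {F₂ : M → ℝ} {f₂ : M' → ℝ} (hF₂ : IsMorseAdapted (𝓡∂ (n + 1)) F₂) (hf₂ : IsMorseAdapted (𝓡∂ (n + 1)) f₂)
    {p : M} {p' : M'} {b τ₀ σ h₀ : ℝ} (hFp : F₂ p = h₀) (hfp' : f₂ p' = h₀ + σ)
    (hτ₀ : 0 < τ₀) (hbh : b < h₀) (hh1 : h₀ < 1) (hh1' : h₀ + σ < 1)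
    (hreg₂ : ∀ x, b - τ₀ ≤ F₂ x → x ≠ p → ¬ IsMCriticalPt (𝓡∂ (n + 1)) F₂ x)
    (hreg₂' : ∀ y, b + σ - τ₀ ≤ f₂ y → y ≠ p' → ¬ IsMCriticalPt (𝓡∂ (n + 1)) f₂ y)
    {g₀ : M → M'} {g₀' : M' → M}
    (hg₀ : ∀ x, F₂ x < b - τ₀ / 4 → ContMDiffAt (𝓡∂ (n + 1)) (𝓡∂ (n + 1)) ∞ g₀ x)
    (hg₀' : ∀ y, f₂ y < b + σ - τ₀ / 4 → ContMDiffAt (𝓡∂ (n + 1)) (𝓡∂ (n + 1)) ∞ g₀' y)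
    (hlev₀ : ∀ x, F₂ x ≤ b - τ₀ / 4 → f₂ (g₀ x) = F₂ x + σ)
    (hlev₀' : ∀ y, f₂ y ≤ b + σ - τ₀ / 4 → F₂ (g₀' y) = f₂ y - σ)
    (hinv₀ : ∀ x, F₂ x ≤ b - τ₀ / 4 → g₀' (g₀ x) = x)
    (hinv₀' : ∀ y, f₂ y ≤ b + σ - τ₀ / 4 → g₀ (g₀' y) = y)
    (oM : SmoothOrientation (𝓡∂ (n + 1)) M) (oM' : SmoothOrientation (𝓡∂ (n + 1)) M') (hn1 : 1 ≤ n) : Prop where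
  /-- The level map preserves the canonical orientations. -/
  pres :
    letI csC : ChartedSpace (ℍ (n + 1)) ↥(F₂ ⁻¹' Iic (b - τ₀ / 2)) :=
      (sublevelAtlas hF₂.isMorse.contMDiff (b - τ₀ / 2) (hF₂.isInteriorPoint_of_le_lt_one (by linarith))
        (not_isMCriticalPt_of_level hreg₂ hFp (by linarith) (by linarith))).chartedSpace
    letI csC' : ChartedSpace (ℍ (n + 1)) ↥(f₂ ⁻¹' Iic (b - τ₀ / 2 + σ)) :=
      (sublevelAtlas hf₂.isMorse.contMDiff (b - τ₀ / 2 + σ) (hf₂.isInteriorPoint_of_le_lt_one (by linarith))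
        (not_isMCriticalPt_of_level hreg₂' hfp' (by linarith) (by linarith))).chartedSpace
    haveI : IsManifold (𝓡∂ (n + 1)) ∞ ↥(F₂ ⁻¹' Iic (b - τ₀ / 2)) :=
      (sublevelAtlas hF₂.isMorse.contMDiff (b - τ₀ / 2) (hF₂.isInteriorPoint_of_le_lt_one (by linarith))
        (not_isMCriticalPt_of_level hreg₂ hFp (by linarith) (by linarith))).isManifold
    haveI : IsManifold (𝓡∂ (n + 1)) ∞ ↥(f₂ ⁻¹' Iic (b - τ₀ / 2 + σ)) :=
      (sublevelAtlas hf₂.isMorse.contMDiff (b - τ₀ / 2 + σ) (hf₂.isInteriorPoint_of_le_lt_one (by linarith))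
        (not_isMCriticalPt_of_level hreg₂' hfp' (by linarith) (by linarith))).isManifold
    (levelDiffeomorphOfMaps (rawSlab hF₂.isMorse.contMDiff hF₂.le_one) (rawSlab hf₂.isMorse.contMDiff hf₂.le_one)
        (ℓ := b - τ₀ / 2) (ℓ' := b - τ₀ / 2 + σ) rfl rfl (g := g₀) (g' := g₀')
        (fun x hx => by
          have hx' : F₂ x = b - τ₀ / 2 := hx
          show f₂ (g₀ x) = b - τ₀ / 2 + σ
          rw [hlev₀ x (by linarith), hx'])
        (fun y hy => by
          have hy' : f₂ y = b - τ₀ / 2 + σ := hy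
          show F₂ (g₀' y) = b - τ₀ / 2
          rw [hlev₀' y (by linarith), hy']; ring)
        hn1 (fun x (hx : F₂ x = b - τ₀ / 2) => hg₀ x (by linarith))
        (fun y (hy : f₂ y = b - τ₀ / 2 + σ) => hg₀' y (by linarith))
        (fun x (hx : F₂ x = b - τ₀ / 2) => hinv₀ x (by linarith))
        (fun y (hy : f₂ y = b - τ₀ / 2 + σ) => hinv₀' y (by linarith))).IsOrientationPreserving
      ((rawSlab hF₂.isMorse.contMDiff hF₂.le_one).levelOrientation (ℓ := b - τ₀ / 2) rfl oM hn1)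
      ((rawSlab hf₂.isMorse.contMDiff hf₂.le_one).levelOrientation (ℓ := b - τ₀ / 2 + σ) rfl oM' hn1)

/-- **The character of a lifted foot of a Morse chart of index `1`** — stated on field-free
data (the handle chart `HandleChart.ofEqOn` of the chart with the pulled-back model field, the
trivial slab). [cite: Kosinski1993, VI (6.6)] -/
structure FootStatement {F₂ : M → ℝ} (hF₂ : IsMorseAdapted (𝓡∂ (n + 1)) F₂) {p : M} {b τ₀ h₀ ε : ℝ} (hFp : F₂ p = h₀)
    (hτ₀ : 0 < τ₀) (hεpos : 0 < ε) (hε30 : 30 * ε ^ 2 ≤ h₀ - b) (hh1 : h₀ + 17 * ε ^ 2 < 1)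
    (hreg₂ : ∀ x, b - τ₀ ≤ F₂ x → x ≠ p → ¬ IsMCriticalPt (𝓡∂ (n + 1)) F₂ x)
    {φ₀ : OpenPartialHomeomorph M (ℍ (n + 1))} (hφ₀ : φ₀ ∈ IsManifold.maximalAtlas (𝓡∂ (n + 1)) ∞ M) (hpφ₀ : p ∈ φ₀.source)
    (hfq : ∀ q ∈ φ₀.source, F₂ q = F₂ p + milnorQuadratic 1 (φ₀.extend (𝓡∂ (n + 1)) q - φ₀.extend (𝓡∂ (n + 1)) p))
    (hball5 : closedBall (φ₀.extend (𝓡∂ (n + 1)) p) (5 * ε) ⊆ (φ₀.extend (𝓡∂ (n + 1))).target)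
    (oM : SmoothOrientation (𝓡∂ (n + 1)) M) (hn1 : 1 ≤ n) {s : ℝ} (hs : s ^ 2 = 1)
    (o₀ : Orientation ℝ (𝔼 n) (Fin (finrank ℝ (𝔼 n)))) : Prop where
  /-- The lifted foot of sign `s` preserves `(o₀, canonical)`. -/
  pres :
    letI csA : ChartedSpace (ℍ (n + 1)) ↥(F₂ ⁻¹' Iic (F₂ p - (F₂ p - (h₀ - ε ^ 2 / 2)))) :=
      (sublevelAtlas hF₂.isMorse.contMDiff (F₂ p - (F₂ p - (h₀ - ε ^ 2 / 2)))
        (hF₂.isInteriorPoint_of_le_lt_one (by have := pow_pos hεpos 2; linarith))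
        (not_isMCriticalPt_of_level hreg₂ hFp (by have := pow_pos hεpos 2; linarith)
          (ne_of_lt (by have := pow_pos hεpos 2; linarith)))).chartedSpace
    haveI : IsManifold (𝓡∂ (n + 1)) ∞ ↥(F₂ ⁻¹' Iic (F₂ p - (F₂ p - (h₀ - ε ^ 2 / 2)))) :=
      (sublevelAtlas hF₂.isMorse.contMDiff (F₂ p - (F₂ p - (h₀ - ε ^ 2 / 2)))
        (hF₂.isInteriorPoint_of_le_lt_one (by have := pow_pos hεpos 2; linarith))
        (not_isMCriticalPt_of_level hreg₂ hFp (by have := pow_pos hεpos 2; linarith)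
          (ne_of_lt (by have := pow_pos hεpos 2; linarith)))).isManifold
    IsOrientationPreserving (SmoothOrientation.modelSpace o₀)
      ((rawSlab hF₂.isMorse.contMDiff hF₂.le_one).levelOrientation (ℓ := F₂ p - (F₂ p - (h₀ - ε ^ 2 / 2))) rfl oM hn1)
      (HandleChart.TransferData.footLift (D := HandleChart.ofEqOn φ₀ hφ₀ hpφ₀ 1 (r := ε / 10) (by linarith) hfq (fun _ _ => rfl))
        (R := ε) (m := F₂ p - (h₀ - ε ^ 2 / 2))
        ⟨(closedBall_subset_closedBall (by linarith)).trans hball5, hF₂.isMorse.contMDiff,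
          hF₂.isInteriorPoint_of_le_lt_one (by have := pow_pos hεpos 2; linarith),
          not_isMCriticalPt_of_level hreg₂ hFp (by have := pow_pos hεpos 2; linarith) (ne_of_lt (by have := pow_pos hεpos 2; linarith)),
          rfl, rfl, by rw [hFp]; have := pow_pos hεpos 2; linarith, hn1, hεpos⟩
        (ρ := ε / 5) (by linarith) (by rw [hFp]; nlinarith) hs)

/-- **The two feet of a Morse chart of index `1` have opposite characters** for the canonical
orientation of their (connected) level — field-free form. [cite: Kosinski1993, VI (6.6)] -/
theorem footStatement_neg_one_iff {F₂ : M → ℝ} (hF₂ : IsMorseAdapted (𝓡∂ (n + 1)) F₂) {p : M} {b τ₀ h₀ ε : ℝ} (hFp : F₂ p = h₀)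
    (hτ₀ : 0 < τ₀) (hεpos : 0 < ε) (hε30 : 30 * ε ^ 2 ≤ h₀ - b) (hh1 : h₀ + 17 * ε ^ 2 < 1)
    (hreg₂ : ∀ x, b - τ₀ ≤ F₂ x → x ≠ p → ¬ IsMCriticalPt (𝓡∂ (n + 1)) F₂ x)
    {φ₀ : OpenPartialHomeomorph M (ℍ (n + 1))} (hφ₀ : φ₀ ∈ IsManifold.maximalAtlas (𝓡∂ (n + 1)) ∞ M) (hpφ₀ : p ∈ φ₀.source)
    (hfq : ∀ q ∈ φ₀.source, F₂ q = F₂ p + milnorQuadratic 1 (φ₀.extend (𝓡∂ (n + 1)) q - φ₀.extend (𝓡∂ (n + 1)) p))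
    (hball5 : closedBall (φ₀.extend (𝓡∂ (n + 1)) p) (5 * ε) ⊆ (φ₀.extend (𝓡∂ (n + 1))).target)
    (oM : SmoothOrientation (𝓡∂ (n + 1)) M) (hn1 : 1 ≤ n)
    (hconn : letI := (sublevelAtlas hF₂.isMorse.contMDiff (F₂ p - (F₂ p - (h₀ - ε ^ 2 / 2)))
        (hF₂.isInteriorPoint_of_le_lt_one (by have := pow_pos hεpos 2; linarith))
        (not_isMCriticalPt_of_level hreg₂ hFp (by have := pow_pos hεpos 2; linarith)
          (ne_of_lt (by have := pow_pos hεpos 2; linarith)))).chartedSpace;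
      ConnectedSpace ↥((𝓡∂ (n + 1)).boundary ↥(F₂ ⁻¹' Iic (F₂ p - (F₂ p - (h₀ - ε ^ 2 / 2))))))
    (o₀ : Orientation ℝ (𝔼 n) (Fin (finrank ℝ (𝔼 n)))) :
    FootStatement hF₂ hFp hτ₀ hεpos hε30 hh1 hreg₂ hφ₀ hpφ₀ hfq hball5 oM hn1 neg_one_sq o₀ ↔
      ¬ FootStatement hF₂ hFp hτ₀ hεpos hε30 hh1 hreg₂ hφ₀ hpφ₀ hfq hball5 oM hn1 (one_pow 2) o₀ := by
  letI csA : ChartedSpace (ℍ (n + 1)) ↥(F₂ ⁻¹' Iic (F₂ p - (F₂ p - (h₀ - ε ^ 2 / 2)))) :=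
    (sublevelAtlas hF₂.isMorse.contMDiff (F₂ p - (F₂ p - (h₀ - ε ^ 2 / 2)))
      (hF₂.isInteriorPoint_of_le_lt_one (by have := pow_pos hεpos 2; linarith))
      (not_isMCriticalPt_of_level hreg₂ hFp (by have := pow_pos hεpos 2; linarith)
        (ne_of_lt (by have := pow_pos hεpos 2; linarith)))).chartedSpace
  haveI : IsManifold (𝓡∂ (n + 1)) ∞ ↥(F₂ ⁻¹' Iic (F₂ p - (F₂ p - (h₀ - ε ^ 2 / 2)))) :=
    (sublevelAtlas hF₂.isMorse.contMDiff (F₂ p - (F₂ p - (h₀ - ε ^ 2 / 2)))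
      (hF₂.isInteriorPoint_of_le_lt_one (by have := pow_pos hεpos 2; linarith))
      (not_isMCriticalPt_of_level hreg₂ hFp (by have := pow_pos hεpos 2; linarith)
        (ne_of_lt (by have := pow_pos hεpos 2; linarith)))).isManifold
  haveI := hconn
  have T : HandleChart.TransferData (HandleChart.ofEqOn φ₀ hφ₀ hpφ₀ 1 (r := ε / 10) (by linarith) hfq (fun _ _ => rfl))
      ε (F₂ p - (h₀ - ε ^ 2 / 2)) :=
    ⟨(closedBall_subset_closedBall (by linarith)).trans hball5, hF₂.isMorse.contMDiff,
      hF₂.isInteriorPoint_of_le_lt_one (by have := pow_pos hεpos 2; linarith),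
      not_isMCriticalPt_of_level hreg₂ hFp (by have := pow_pos hεpos 2; linarith) (ne_of_lt (by have := pow_pos hεpos 2; linarith)),
      rfl, rfl, by rw [hFp]; have := pow_pos hεpos 2; linarith, hn1, hεpos⟩
  have hρ : (0 : ℝ) < ε / 5 := by linarith
  have hmR : F₂ p - (h₀ - ε ^ 2 / 2) + 2 * (ε / 5) ^ 2 ≤ ε ^ 2 := by rw [hFp]; nlinarith
  set oV := (rawSlab hF₂.isMorse.contMDiff hF₂.le_one).levelOrientation (ℓ := F₂ p - (F₂ p - (h₀ - ε ^ 2 / 2))) rfl oM hn1 with hoV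
  have hoct := T.footLift_isOrientationPreserving_iff_neg_of_connected oM oV hρ hmR o₀
  have hdef := isOrientationPreserving_neg_iff_not (T.isSmoothEmbedding_footLift hρ hmR neg_one_sq)
    (T.isOpen_range_footLift_gen hρ hmR neg_one_sq) oV o₀
  constructor
  · intro h hp; exact (hdef.1 (hoct.1 hp.1)) h.1
  · intro h; by_contra h'; exact h ⟨hoct.2 (hdef.2 fun hh => h' ⟨hh⟩)⟩

end Statements

namespace OneHandleStepContext

variable {n : ℕ} {M : Type u} [TopologicalSpace M] [ChartedSpace (ℍ (n + 1)) M] [IsManifold (𝓡∂ (n + 1)) ∞ M]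
  {M' : Type u} [TopologicalSpace M'] [ChartedSpace (ℍ (n + 1)) M'] [IsManifold (𝓡∂ (n + 1)) ∞ M']
  (C : OneHandleStepContext n M M')

/-- The trivial slab of `M` (same function as `C.Sl`, no field). [folklore] -/
@[reducible] def rawSl : UnitSlab (n := n) M := rawSlab C.S.hf C.hF.le_one

/-- The trivial slab of `M'`. [folklore] -/
@[reducible] def rawSl' : UnitSlab (n := n) M' := rawSlab C.S'.hf C.hF'.le_one

/-- **The seed level map read on the trivial slabs** (the same map as `C.Ψlev`). [folklore] -/
def rawΨ : C.rawSl.Level C.c ≃ₘ⟮𝓡 n, 𝓡 n⟯ C.rawSl'.Level (C.c + C.σ) :=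
  levelDiffeomorphOfMaps C.rawSl C.rawSl' rfl rfl (g := C.g₀) (g' := C.g₀')
    (fun x hx => by
      have hx' : C.S.f x = C.c := hx
      show C.S'.f (C.g₀ x) = C.c + C.σ
      rw [C.hlev₀ x (by linarith [C.τ_pos]), hx'])
    (fun y hy => by
      have hy' : C.S'.f y = C.c + C.σ := hy
      show C.S.f (C.g₀' y) = C.c
      rw [C.hlev₀' y (by linarith [C.τ_pos]), hy']; ring)
    C.hn1 (fun x hx => C.hg₀ x (by have hx' : C.S.f x = C.c := hx; linarith [C.τ_pos]))
    (fun y hy => C.hg₀' y (by have hy' : C.S'.f y = C.c + C.σ := hy; linarith [C.τ_pos]))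
    (fun x hx => C.hinv₀ x (by have hx' : C.S.f x = C.c := hx; linarith [C.τ_pos]))
    (fun y hy => C.hinv₀' y (by have hy' : C.S'.f y = C.c + C.σ := hy; linarith [C.τ_pos]))

/-- `SeedPres` read on the trivial slabs. [folklore] -/
structure RawSeedPres : Prop where
  /-- `rawΨ` preserves the canonical orientations. -/
  pres : C.rawΨ.IsOrientationPreserving (C.rawSl.levelOrientation rfl C.oM C.hn1) (C.rawSl'.levelOrientation rfl C.oM' C.hn1)

/-- `FootChar` read on the trivial slab. [folklore] -/
structure RawFootChar (o₀ : Orientation ℝ (𝔼 n) (Fin (finrank ℝ (𝔼 n)))) : Prop where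
  /-- The lifted `+` foot preserves `(o₀, canonical)`. -/
  pres : IsOrientationPreserving (SmoothOrientation.modelSpace o₀)
    (C.rawSl.levelOrientation (ℓ := C.S.f C.S.p - C.m) rfl C.oM C.hn1) (C.T.footLift C.ρ_pos C.hmR (one_pow 2))

/-- `FootChar'` (for either foot) read on the trivial slab. [folklore] -/
structure RawFootChar' {s : ℝ} (hs : s ^ 2 = 1) (o₀ : Orientation ℝ (𝔼 n) (Fin (finrank ℝ (𝔼 n)))) : Prop where
  /-- The lifted foot of sign `s` of `M'` preserves `(o₀, canonical)`. -/
  pres : IsOrientationPreserving (SmoothOrientation.modelSpace o₀)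
    (C.rawSl'.levelOrientation (ℓ := C.S'.f C.S'.p - C.m') rfl C.oM' C.hn1) (C.T'.footLift C.ρ_pos C.hmR' hs)

/-- `SeedPres` is field-free. [folklore] -/
theorem seedPres_iff_raw : C.SeedPres ↔ C.RawSeedPres := ⟨fun h => ⟨h.1⟩, fun h => ⟨h.1⟩⟩

/-- `FootChar` is field-free up to the handle chart. [folklore] -/
theorem footChar_iff_raw (o₀ : Orientation ℝ (𝔼 n) (Fin (finrank ℝ (𝔼 n)))) : C.FootChar o₀ ↔ C.RawFootChar o₀ :=
  ⟨fun h => ⟨h.1⟩, fun h => ⟨h.1⟩⟩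

/-- `FootChar'` is field-free up to the handle chart. [folklore] -/
theorem footChar'_iff_raw (o₀ : Orientation ℝ (𝔼 n) (Fin (finrank ℝ (𝔼 n)))) : C.FootChar' o₀ ↔ C.RawFootChar' (one_pow 2) o₀ :=
  ⟨fun h => ⟨h.1⟩, fun h => ⟨h.1⟩⟩

/-- **Opposite characters of the two feet of `M'`**, read on the trivial slab. [cite: Kosinski1993, VI (6.6)] -/
theorem rawFootChar'_neg_one_iff (o₀ : Orientation ℝ (𝔼 n) (Fin (finrank ℝ (𝔼 n)))) :
    C.RawFootChar' neg_one_sq o₀ ↔ ¬ C.FootChar' o₀ := by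
  rw [C.footChar'_iff_raw]
  have hoct := C.T'.footLift_isOrientationPreserving_iff_neg_of_connected C.oM'
    (C.rawSl'.levelOrientation (ℓ := C.S'.f C.S'.p - C.m') rfl C.oM' C.hn1) C.ρ_pos C.hmR' o₀
  have hdef := isOrientationPreserving_neg_iff_not (C.T'.isSmoothEmbedding_footLift C.ρ_pos C.hmR' neg_one_sq)
    (C.isOpen_range_footLift' neg_one_sq) (C.rawSl'.levelOrientation (ℓ := C.S'.f C.S'.p - C.m') rfl C.oM' C.hn1) o₀
  constructor
  · intro h hp; exact (hdef.1 (hoct.1 hp.1)) h.1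
  · intro h; by_contra h'; exact h ⟨hoct.2 (hdef.2 fun hh => h' ⟨hh⟩)⟩

end OneHandleStepContext


/-! ### The context built from the data of the level step -/

section Data

variable {n : ℕ} {M : Type u} [TopologicalSpace M] [T2Space M] [CompactSpace M]
  [ChartedSpace (ℍ (n + 1)) M] [IsManifold (𝓡∂ (n + 1)) ∞ M]
  {M' : Type u} [TopologicalSpace M'] [T2Space M'] [CompactSpace M']
  [ChartedSpace (ℍ (n + 1)) M'] [IsManifold (𝓡∂ (n + 1)) ∞ M']

/-- **The context of the step together with the feet formulas of its two handle charts.**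
[cite: MilnorHCobordism1965, proof of Thm. 3.13] -/
structure LevelStepData (n : ℕ) (M M' : Type u) [TopologicalSpace M] [ChartedSpace (ℍ (n + 1)) M] [IsManifold (𝓡∂ (n + 1)) ∞ M]
    [TopologicalSpace M'] [ChartedSpace (ℍ (n + 1)) M'] [IsManifold (𝓡∂ (n + 1)) ∞ M']
    (SP : Prop) (FC FC' : Orientation ℝ (𝔼 n) (Fin (finrank ℝ (𝔼 n))) → Prop) (CN : Prop) where
  /-- The context. -/
  C : OneHandleStepContext n M M'
  /-- `SeedPres` read on the field-free statement. -/
  hseed : C.SeedPres ↔ SP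
  /-- `FootChar` read on the field-free statement. -/
  hchar : ∀ o, C.FootChar o ↔ FC o
  /-- `FootChar'` read on the field-free statement. -/
  hchar' : ∀ o, C.FootChar' o ↔ FC' o
  /-- The foot level of `M'` is connected (field-free form). -/
  conn : CN

set_option maxHeartbeats 4000000 in
/-- **Construction of the context** from the data of the level step: handle sides on both
manifolds (`exists_handleSide_data`; the field of `M` is pulled back from the field of `M'` on
the seed collar), with all the constants of `OneHandleStepContext`.
[cite: MilnorHCobordism1965, proof of Thm. 3.13; Kosinski1993, VI (6.4)] -/
def levelStepData (hn : 2 ≤ n) (hn1 : 1 ≤ n) {F₂ : M → ℝ} {f₂ : M' → ℝ} (hF₂ : IsMorseAdapted (𝓡∂ (n + 1)) F₂) (hf₂ : IsMorseAdapted (𝓡∂ (n + 1)) f₂)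
    {p : M} {p' : M'} {b τ₀ σ h₀ ε : ℝ} (hFp : F₂ p = h₀) (hfp' : f₂ p' = h₀ + σ)
    (hτ₀ : 0 < τ₀) (hεpos : 0 < ε) (hε4 : ε ≤ 1 / 4) (hε30 : 30 * ε ^ 2 ≤ h₀ - b) (hε30' : 30 * ε ^ 2 ≤ h₀ + σ - (b + σ))
    (hh1 : h₀ + 17 * ε ^ 2 < 1) (hh1' : h₀ + σ + 17 * ε ^ 2 < 1) (hbh : b < h₀) (hh1₀ : h₀ < 1) (hh1₀' : h₀ + σ < 1)
    (hreg₂ : ∀ x, b - τ₀ ≤ F₂ x → x ≠ p → ¬ IsMCriticalPt (𝓡∂ (n + 1)) F₂ x)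
    (hreg₂' : ∀ y, b + σ - τ₀ ≤ f₂ y → y ≠ p' → ¬ IsMCriticalPt (𝓡∂ (n + 1)) f₂ y)
    {φ₀ : OpenPartialHomeomorph M (ℍ (n + 1))} (hφ₀ : φ₀ ∈ IsManifold.maximalAtlas (𝓡∂ (n + 1)) ∞ M) (hpφ₀ : p ∈ φ₀.source)
    (hfq : ∀ q ∈ φ₀.source, F₂ q = F₂ p + milnorQuadratic 1 (φ₀.extend (𝓡∂ (n + 1)) q - φ₀.extend (𝓡∂ (n + 1)) p))
    (hball5 : closedBall (φ₀.extend (𝓡∂ (n + 1)) p) (5 * ε) ⊆ (φ₀.extend (𝓡∂ (n + 1))).target)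
    {φ' : OpenPartialHomeomorph M' (ℍ (n + 1))} (hφ' : φ' ∈ IsManifold.maximalAtlas (𝓡∂ (n + 1)) ∞ M') (hpφ' : p' ∈ φ'.source)
    (hfq' : ∀ q ∈ φ'.source, f₂ q = f₂ p' + milnorQuadratic 1 (φ'.extend (𝓡∂ (n + 1)) q - φ'.extend (𝓡∂ (n + 1)) p'))
    (hball5' : closedBall (φ'.extend (𝓡∂ (n + 1)) p') (5 * ε) ⊆ (φ'.extend (𝓡∂ (n + 1))).target)
    {φ₁ : OpenPartialHomeomorph M' (ℍ (n + 1))} (hφ₁ : φ₁ ∈ IsManifold.maximalAtlas (𝓡∂ (n + 1)) ∞ M') (hpφ₁ : p' ∈ φ₁.source)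
    (hfq₁ : ∀ q ∈ φ₁.source, f₂ q = f₂ p' + milnorQuadratic 1 (φ₁.extend (𝓡∂ (n + 1)) q - φ₁.extend (𝓡∂ (n + 1)) p'))
    (hball5₁ : closedBall (φ₁.extend (𝓡∂ (n + 1)) p') (5 * ε) ⊆ (φ₁.extend (𝓡∂ (n + 1))).target)
    {s₀ : ℝ} (hs₀ : s₀ ^ 2 = 1)
    (hfeetφ' : ∀ w : 𝔼 n, (φ'.extend (𝓡∂ (n + 1))).symm (φ'.extend (𝓡∂ (n + 1)) p' + footModel n 1 (f₂ p' - (h₀ + σ - ε ^ 2 / 2)) (ε / 5) w) =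
      (φ₁.extend (𝓡∂ (n + 1))).symm (φ₁.extend (𝓡∂ (n + 1)) p' + footModel n s₀ (f₂ p' - (h₀ + σ - ε ^ 2 / 2)) (ε / 5) w))
    {g₀ : M → M'} {g₀' : M' → M}
    (hg₀ : ∀ x, F₂ x < b - τ₀ / 4 → ContMDiffAt (𝓡∂ (n + 1)) (𝓡∂ (n + 1)) ∞ g₀ x)
    (hg₀' : ∀ y, f₂ y < b + σ - τ₀ / 4 → ContMDiffAt (𝓡∂ (n + 1)) (𝓡∂ (n + 1)) ∞ g₀' y)
    (hlev₀ : ∀ x, F₂ x ≤ b - τ₀ / 4 → f₂ (g₀ x) = F₂ x + σ)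
    (hlev₀' : ∀ y, f₂ y ≤ b + σ - τ₀ / 4 → F₂ (g₀' y) = f₂ y - σ)
    (hinv₀ : ∀ x, F₂ x ≤ b - τ₀ / 4 → g₀' (g₀ x) = x)
    (hinv₀' : ∀ y, f₂ y ≤ b + σ - τ₀ / 4 → g₀ (g₀' y) = y)
    (hpull : ∀ (X' : Π y : M', TangentSpace (𝓡∂ (n + 1)) y),
      ContMDiff (𝓡∂ (n + 1)) (𝓡∂ (n + 1)).tangent ∞ (fun y => (⟨y, X' y⟩ : TangentBundle (𝓡∂ (n + 1)) M')) →
      ∃ ξ₂ : Π x : M, TangentSpace (𝓡∂ (n + 1)) x,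
        ContMDiffOn (𝓡∂ (n + 1)) (𝓡∂ (n + 1)).tangent ∞ (fun x => (⟨x, ξ₂ x⟩ : TangentBundle (𝓡∂ (n + 1)) M)) {x | F₂ x < b - τ₀ / 4} ∧
        (∀ x, F₂ x < b - τ₀ / 4 → mlineDeriv (𝓡∂ (n + 1)) f₂ (g₀ x) (X' (g₀ x)) = 1 → mlineDeriv (𝓡∂ (n + 1)) F₂ x (ξ₂ x) = 1) ∧
        ∀ x, F₂ x < b - τ₀ / 4 → mfderiv (𝓡∂ (n + 1)) (𝓡∂ (n + 1)) g₀ x (ξ₂ x) = X' (g₀ x))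
    (hconnc : IsConnected (F₂ ⁻¹' {b - τ₀ / 2}))
    (oM : SmoothOrientation (𝓡∂ (n + 1)) M) (oM' : SmoothOrientation (𝓡∂ (n + 1)) M') :
    LevelStepData n M M'
      (SeedStatement hF₂ hf₂ hFp hfp' hτ₀ hbh hh1₀ hh1₀' hreg₂ hreg₂' hg₀ hg₀' hlev₀ hlev₀' hinv₀ hinv₀' oM oM' hn1)
      (fun o => FootStatement hF₂ hFp hτ₀ hεpos hε30 hh1 hreg₂ hφ₀ hpφ₀ hfq hball5 oM hn1 (one_pow 2) o)
      (fun o => FootStatement hf₂ hfp' hτ₀ hεpos hε30' hh1' hreg₂' hφ₁ hpφ₁ hfq₁ hball5₁ oM' hn1 hs₀ o)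
      (letI := (sublevelAtlas hf₂.isMorse.contMDiff (f₂ p' - (f₂ p' - (h₀ + σ - ε ^ 2 / 2)))
          (hf₂.isInteriorPoint_of_le_lt_one (by have := pow_pos hεpos 2; linarith))
          (not_isMCriticalPt_of_level hreg₂' hfp' (by have := pow_pos hεpos 2; linarith)
            (ne_of_lt (by have := pow_pos hεpos 2; linarith)))).chartedSpace;
        ConnectedSpace ↥((𝓡∂ (n + 1)).boundary ↥(f₂ ⁻¹' Iic (f₂ p' - (f₂ p' - (h₀ + σ - ε ^ 2 / 2)))))) := by
  /- The constants. -/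
  have hεsq : ε ^ 2 ≤ ε := by
    have := mul_le_mul_of_nonneg_left (show ε ≤ 1 by linarith) hεpos.le
    rw [pow_two]; linarith
  have hε2pos : 0 < ε ^ 2 := by positivity
  let τ : ℝ := min (τ₀ / 32) (ε ^ 2 / 100)
  have hτpos : 0 < τ := lt_min (by linarith) (by linarith)
  have hττ₀ : τ ≤ τ₀ / 32 := min_le_left _ _
  have hτε : τ ≤ ε ^ 2 / 100 := min_le_right _ _
  let c : ℝ := b - τ₀ / 2
  let r : ℝ := ε / 10
  have hrpos : 0 < r := by show 0 < ε / 10; linarith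
  have hr2 : r ^ 2 = ε ^ 2 / 100 := by show (ε / 10) ^ 2 = _; ring
  let γ : ℝ := 32 * r ^ 4
  have hγval : γ = 32 / 10000 * (ε ^ 2 * ε ^ 2) := by show 32 * (ε / 10) ^ 4 = _; ring
  have hγε : γ / ε ^ 2 = 32 / 10000 * ε ^ 2 := by rw [hγval]; field_simp
  have hγε' : γ / (4 * ε ^ 2) = 8 / 10000 * ε ^ 2 := by rw [hγval]; field_simp; ring
  have hγpos : 0 < γ := by show 0 < 32 * r ^ 4; positivity
  let a : ℝ := h₀ - ε ^ 2 / 2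
  let η : ℝ := min (τ / 9) (ε ^ 2 / 100)
  have hηpos : 0 < η := lt_min (by linarith) (by linarith)
  have hητ : 9 * η ≤ τ := by have := min_le_left (τ / 9) (ε ^ 2 / 100); linarith
  have hηε : η ≤ ε ^ 2 / 100 := min_le_right _ _
  let δ : ℝ := ε ^ 2 / 100
  have hδpos : 0 < δ := by show 0 < ε ^ 2 / 100; linarith
  let ℓu : ℝ := h₀ + ε ^ 2
  let ℓ₀ : ℝ := b - 3 * τ₀ / 4
  let ℓ₁ : ℝ := c - 4 * τ
  let ℓ₂ : ℝ := h₀ + 16 * ε ^ 2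
  let ℓ₃ : ℝ := (ℓ₂ + 1) / 2
  have hcdef : c = b - τ₀ / 2 := rfl
  have hadef : a = h₀ - ε ^ 2 / 2 := rfl
  have hℓ₁def : ℓ₁ = c - 4 * τ := rfl
  have hℓ₂def : ℓ₂ = h₀ + 16 * ε ^ 2 := rfl
  have hℓudef : ℓu = h₀ + ε ^ 2 := rfl
  have hδdef : δ = ε ^ 2 / 100 := rfl
  have hℓ₀def : ℓ₀ = b - 3 * τ₀ / 4 := rfl
  have hℓ₃def : ℓ₃ = (ℓ₂ + 1) / 2 := rfl
  have hℓ₂1 : ℓ₂ < 1 := by rw [hℓ₂def]; linarith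
  have h01 : ℓ₀ < ℓ₁ := by rw [hℓ₀def, hℓ₁def, hcdef]; linarith
  have h23 : ℓ₂ < ℓ₃ := by rw [hℓ₃def]; linarith
  have hℓ₃1 : ℓ₃ < 1 := by rw [hℓ₃def]; linarith
  have hcτ : c + 8 * τ ≤ h₀ - 25 * ε ^ 2 := by rw [hcdef]; linarith
  have h8 : 8 * r ^ 2 ≤ 1 := by rw [hr2]; linarith
  have hrε : 2 * r < ε := by show 2 * (ε / 10) < ε; linarith
  have hlow : h₀ - ε ^ 2 + γ / ε ^ 2 < a - η / 4 := by rw [hγε, hadef]; linarith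
  have hal : a - η / 4 ≤ h₀ - 4 * r ^ 2 := by rw [hadef, hr2]; linarith
  have hau : h₀ + 4 * r ^ 2 ≤ ℓu - δ := by rw [hℓudef, hδdef, hr2]; linarith
  have hhigh : ℓu < h₀ + 4 * ε ^ 2 - γ / (4 * ε ^ 2) := by rw [hγε', hℓudef]; linarith
  have hℓ₁fp : ℓ₁ ≤ h₀ - 16 * ε ^ 2 := by rw [hℓ₁def, hcdef]; linarith
  have hℓ₁a : ℓ₁ < a - (ℓu - a) - η := by rw [hℓ₁def, hcdef, hadef, hℓudef]; linarith
  have haℓu : a + η < ℓu - δ := by rw [hadef, hℓudef, hδdef]; linarith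
  have hℓuℓ₂ : ℓu < ℓ₂ := by rw [hℓudef, hℓ₂def]; linarith
  have hcb : c + 2 * τ < b - τ₀ / 4 := by rw [hcdef]; linarith
  let a' : ℝ := h₀ + σ - ε ^ 2 / 2
  have ha'def : a' = h₀ + σ - ε ^ 2 / 2 := rfl
  /- The side of `M'`. -/
  have E' := exists_handleSide_data hf₂.isMorse.contMDiff (ℓ₀ := ℓ₀ + σ) (ℓ₁ := ℓ₁ + σ) (ℓ₂ := ℓ₂ + σ) (ℓ₃ := (ℓ₂ + σ + 1) / 2)
    (by linarith) (by linarith) (fun x hx => by rw [(hf₂.2.1 x hx).1]; linarith) hφ' hpφ' hfq'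
    (ε := ε) (r := r) (γ := γ) (η := η) (a := a') (ℓu := ℓu + σ) (δ := δ) hεpos hrpos h8 hrε le_rfl hηpos hδpos hball5'
    (by rw [hfp']; linarith) (by rw [hfp']; linarith)
    (fun x hx hxp => hreg₂' x (by have := hx.1; rw [hℓ₀def] at this; linarith) hxp)
    (by rw [hfp', ha'def]; linarith) (by rw [hfp', ha'def]; linarith) (by rw [hfp']; linarith) (by rw [hfp']; linarith)
    (K₂ := ∅) (U₂ := ∅) isClosed_empty isOpen_empty (empty_subset _) (fun x hx => hx.elim) disjoint_bot_left
    (ξ₂ := fun _ => 0) (fun x hx => hx.elim) (fun x hx => hx.elim)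
  let X' := E'.choose
  let θ' := E'.choose_spec.choose
  let D' := E'.choose_spec.choose_spec.choose
  obtain ⟨hXint', hflow', hDk', hDr', hDext', hDsrc', hball3', -, hunit', hspeed', hcl1', hcl2', hcl3', hcore', hcorelt'⟩ :=
    E'.choose_spec.choose_spec.choose_spec
  /- The side of `M`. -/
  have P := hpull X' hXint'.contMDiff
  let ξ₂ := P.choose
  obtain ⟨hξs, hξu, hξrel⟩ := P.choose_spec
  have hK₂ : IsClosed {x : M | F₂ x ∈ Icc (c - τ) (c + τ)} := isClosed_Icc.preimage hF₂.isMorse.contMDiff.continuous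
  have hU₂ : IsOpen {x : M | F₂ x ∈ Ioo (c - 2 * τ) (c + 2 * τ)} := isOpen_Ioo.preimage hF₂.isMorse.contMDiff.continuous
  have hdisj : Disjoint {x : M | F₂ x ∈ Ioo (c - 2 * τ) (c + 2 * τ)}
      (φ₀.source ∩ φ₀.extend (𝓡∂ (n + 1)) ⁻¹' ball (φ₀.extend (𝓡∂ (n + 1)) p) (5 * ε)) := by
    rw [Set.disjoint_left]
    rintro q hq ⟨hqs, hqb⟩
    have h1 := hfq q hqs
    have hnu : ‖φ₀.extend (𝓡∂ (n + 1)) q - φ₀.extend (𝓡∂ (n + 1)) p‖ < 5 * ε := by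
      rw [mem_preimage, mem_ball, dist_eq_norm] at hqb; exact hqb
    have hQ : -(25 * ε ^ 2) ≤ milnorQuadratic 1 (φ₀.extend (𝓡∂ (n + 1)) q - φ₀.extend (𝓡∂ (n + 1)) p) := by
      rw [milnorQuadratic_eq]
      have hA := sqSumLT_le_norm_sq (m := n + 1) 1 (φ₀.extend (𝓡∂ (n + 1)) q - φ₀.extend (𝓡∂ (n + 1)) p)
      have hB := sqSumGE_nonneg (m := n + 1) 1 (φ₀.extend (𝓡∂ (n + 1)) q - φ₀.extend (𝓡∂ (n + 1)) p)
      have hC : ‖φ₀.extend (𝓡∂ (n + 1)) q - φ₀.extend (𝓡∂ (n + 1)) p‖ ^ 2 < (5 * ε) ^ 2 :=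
        pow_lt_pow_left₀ hnu (norm_nonneg _) two_ne_zero
      linarith
    rw [hFp] at h1
    have := hq.2; linarith
  have E := exists_handleSide_data hF₂.isMorse.contMDiff (ℓ₀ := ℓ₀) (ℓ₁ := ℓ₁) (ℓ₂ := ℓ₂) (ℓ₃ := ℓ₃) h01 h23
    (fun x hx => by rw [(hF₂.2.1 x hx).1]; exact hℓ₃1) hφ₀ hpφ₀ hfq
    (ε := ε) (r := r) (γ := γ) (η := η) (a := a) (ℓu := ℓu) (δ := δ) hεpos hrpos h8 hrε le_rfl hηpos hδpos hball5
    (by rw [hFp]; exact hℓ₁fp) (by rw [hFp])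
    (fun x hx hxp => hreg₂ x (by have := hx.1; rw [hℓ₀def] at this; linarith) hxp)
    (by rw [hFp]; exact hlow) (by rw [hFp]; exact hal) (by rw [hFp]; exact hau) (by rw [hFp]; exact hhigh)
    hK₂ hU₂ (fun x hx => ⟨by linarith [hx.1], by linarith [hx.2]⟩)
    (fun x hx => ⟨by have := hx.1; rw [hℓ₁def]; linarith, by have := hx.2; rw [hℓ₂def]; linarith⟩) hdisj
    (hξs.mono fun x hx => show F₂ x < b - τ₀ / 4 by have := hx.2; linarith)
    (fun x hx => hξu x (by have := hx.2; linarith) (by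
      have hlev : f₂ (g₀ x) = F₂ x + σ := hlev₀ x (by have := hx.2; linarith)
      refine hunit' _ ⟨by rw [hlev]; show c - 4 * τ + σ ≤ _; linarith [hx.1], by rw [hlev, hℓ₂def]; linarith [hx.2]⟩ fun hc' => ?_
      have h := D'.abs_sub_lt_of_mem_core hc'
      rw [abs_lt, hlev, hfp', hDr', hr2] at h
      linarith [h.1, hx.2]))
  let X := E.choose
  let θ := E.choose_spec.choose
  let D := E.choose_spec.choose_spec.choose
  obtain ⟨hXint, hflow, hDk, hDr, hDext, hDsrc, hball3, hXK, hunit, hspeed, hcl1, hcl2, hcl3, hcore, hcorelt⟩ :=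
    E.choose_spec.choose_spec.choose_spec
  /- The handle sides and the context. -/
  let S : HandleSide (𝓡∂ (n + 1)) M :=
    { f := F₂, X := X, θ := θ, p := p, D := D, hf := hF₂.isMorse.contMDiff, hX := hXint.contMDiff, flow := hflow
      ε := ε, γ := γ, η := η, a := a, ℓ₁ := ℓ₁, ℓ₂ := ℓ₂, ℓu := ℓu, δ := δ
      ε_pos := hεpos, γ_pos := hγpos, η_pos := hηpos, δ_pos := hδpos, hball := hball3, hunit := hunit, hspeed := hspeed
      isClosed_region := hcl1, isClosed_region_half := hcl2, isClosed_region_small := hcl3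
      core_subset := hcore, lt_of_mem_core := hcorelt
      hlow := by show F₂ p - ε ^ 2 + γ / ε ^ 2 < a - η / 4; rw [hFp]; exact hlow
      hhigh := by show ℓu < F₂ p + 4 * ε ^ 2 - γ / (4 * ε ^ 2); rw [hFp]; exact hhigh
      hℓ₁ := hℓ₁a, ha := haℓu, hℓu := hℓuℓ₂ }
  let S' : HandleSide (𝓡∂ (n + 1)) M' :=
    { f := f₂, X := X', θ := θ', p := p', D := D', hf := hf₂.isMorse.contMDiff, hX := hXint'.contMDiff, flow := hflow'
      ε := ε, γ := γ, η := η, a := a', ℓ₁ := ℓ₁ + σ, ℓ₂ := ℓ₂ + σ, ℓu := ℓu + σ, δ := δ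
      ε_pos := hεpos, γ_pos := hγpos, η_pos := hηpos, δ_pos := hδpos, hball := hball3', hunit := hunit', hspeed := hspeed'
      isClosed_region := hcl1', isClosed_region_half := hcl2', isClosed_region_small := hcl3'
      core_subset := hcore', lt_of_mem_core := hcorelt'
      hlow := by show f₂ p' - ε ^ 2 + γ / ε ^ 2 < a' - η / 4; rw [hfp', ha'def]; linarith
      hhigh := by show ℓu + σ < f₂ p' + 4 * ε ^ 2 - γ / (4 * ε ^ 2); rw [hfp']; linarith
      hℓ₁ := by show ℓ₁ + σ < a' - (ℓu + σ - a') - η; rw [ha'def]; linarith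
      ha := by show a' + η < ℓu + σ - δ; rw [ha'def]; linarith
      hℓu := by show ℓu + σ < ℓ₂ + σ; linarith }
  let C : OneHandleStepContext n M M' :=
      { S := S, S' := S', hn := hn, hF := hF₂, hF' := hf₂, σ := σ, c := c, τ := τ, τ_pos := hτpos
        hk := hDk, hk' := hDk', hr := by show D'.r = D.r; rw [hDr, hDr']
        hε := rfl, hγ := rfl, hη := rfl, hδ := rfl, ha := by show a' = a + σ; rw [ha'def, hadef]; ring
        hℓ₁ := rfl, hℓ₂ := rfl, hℓu := rfl
        hfp := by show f₂ p' = F₂ p + σ; rw [hfp', hFp]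
        hr_eq := by show D.r = ε / 10; rw [hDr]
        hγ_eq := by show γ = 32 * D.r ^ 4; rw [hDr]
        ha_eq := by show a = F₂ p - ε ^ 2 / 2; rw [hFp]
        hℓu_eq := by show ℓu = F₂ p + ε ^ 2; rw [hFp]
        hδ_eq := rfl, hℓ₁_eq := rfl
        hℓ₂_eq := by show ℓ₂ = F₂ p + 16 * ε ^ 2; rw [hFp]
        hε1 := hε4, hτε := hτε, hηε := hηε, hητ := hητ
        hcτ := by show c + 8 * τ ≤ F₂ p - 25 * ε ^ 2; rw [hFp]; exact hcτ
        htop := by show F₂ p + 17 * ε ^ 2 < 1; rw [hFp]; exact hh1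
        htop' := by show f₂ p' + 17 * ε ^ 2 < 1; rw [hfp']; linarith
        hreg := fun x hx hxp => hreg₂ x (by have h' : c - 5 * τ ≤ F₂ x := hx; rw [hcdef] at h'; linarith) hxp
        hreg' := fun y hy hyp => hreg₂' y (by have h' : c + σ - 5 * τ ≤ f₂ y := hy; rw [hcdef] at h'; linarith) hyp
        g₀ := g₀, g₀' := g₀'
        hg₀ := fun x hx => hg₀ x (by have h' : F₂ x < c + 2 * τ := hx; linarith)
        hg₀' := fun y hy => hg₀' y (by have h' : f₂ y < c + σ + 2 * τ := hy; linarith)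
        hlev₀ := fun x hx => hlev₀ x (by have h' : F₂ x ≤ c + 2 * τ := hx; linarith)
        hlev₀' := fun y hy => hlev₀' y (by have h' : f₂ y ≤ c + σ + 2 * τ := hy; linarith)
        hinv₀ := fun x hx => hinv₀ x (by have h' : F₂ x ≤ c + 2 * τ := hx; linarith)
        hinv₀' := fun y hy => hinv₀' y (by have h' : f₂ y ≤ c + σ + 2 * τ := hy; linarith)
        hrel₀ := fun x hx => by
          have hx' : F₂ x ∈ Ioo (c - τ) (c + τ) := hx
          have hK : x ∈ {x : M | F₂ x ∈ Icc (c - τ) (c + τ)} := ⟨hx'.1.le, hx'.2.le⟩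
          have e : X x = ξ₂ x := hXK x hK
          show mfderiv (𝓡∂ (n + 1)) (𝓡∂ (n + 1)) g₀ x (X x) = X' (g₀ x)
          rw [e]
          exact hξrel x (by linarith [hx'.2])
        hconn := hconnc, oM := oM, oM' := oM' }
  letI i₁ := C.instCsFoot; letI i₂ := C.instMfdFoot; letI i₃ := C.instCsC; letI i₄ := C.instMfdC
  letI i₅ := C.instCsFoot'; letI i₆ := C.instMfdFoot'; letI i₇ := C.instCsC'; letI i₈ := C.instMfdC'
  letI j₁ : ChartedSpace (ℍ (n + 1)) ↥(F₂ ⁻¹' Iic (F₂ p - (F₂ p - a))) := C.instCsFoot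
  haveI j₂ : IsManifold (𝓡∂ (n + 1)) ∞ ↥(F₂ ⁻¹' Iic (F₂ p - (F₂ p - a))) := C.instMfdFoot
  letI j₅ : ChartedSpace (ℍ (n + 1)) ↥(f₂ ⁻¹' Iic (f₂ p' - (f₂ p' - a'))) := C.instCsFoot'
  haveI j₆ : IsManifold (𝓡∂ (n + 1)) ∞ ↥(f₂ ⁻¹' Iic (f₂ p' - (f₂ p' - a'))) := C.instMfdFoot'
  refine { C := C, hseed := ?_, hchar := fun o => ?_, hchar' := fun o => ?_, conn := ?_ }
  · -- `SeedPres` on the field-free statement: the same map and orientations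
    exact Iff.trans C.seedPres_iff_raw ⟨fun h => ⟨h.1⟩, fun h => ⟨h.1⟩⟩
  · -- `FootChar`: the feet of `D` are the feet of `φ₀`
    have hm : (0 : ℝ) ≤ F₂ p - a := by rw [hFp, hadef]; have := pow_pos hεpos 2; linarith
    have hρ : (0 : ℝ) < ε / 5 := by linarith
    have hmR : F₂ p - a + 2 * (ε / 5) ^ 2 ≤ ε ^ 2 := by rw [hFp, hadef]; nlinarith
    have hfeet : ∀ w : 𝔼 n, D.foot 1 (F₂ p - a) (ε / 5) w =
        (HandleChart.ofEqOn (X := handlePullback (J := 𝓡∂ (n + 1)) φ₀ p 1 (show (0 : ℝ) < ε / 10 by linarith)) φ₀ hφ₀ hpφ₀ 1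
          (show (0 : ℝ) < ε / 10 by linarith) hfq (fun _ _ => rfl)).foot 1 (F₂ p - a) (ε / 5) w := by
      intro w
      have hnorm : ‖footModel n 1 (F₂ p - a) (ε / 5) w‖ < ε := norm_footModel_lt (one_pow 2) hm hρ hεpos hmR w
      have hu : φ₀.extend (𝓡∂ (n + 1)) p + footModel n 1 (F₂ p - a) (ε / 5) w ∈ ball (φ₀.extend (𝓡∂ (n + 1)) p) (3 * ε) := by
        rw [mem_ball, dist_eq_norm, add_sub_cancel_left]; linarith
      show (D.chart.extend (𝓡∂ (n + 1))).symm (D.chart.extend (𝓡∂ (n + 1)) p + footModel n 1 (F₂ p - a) (ε / 5) w) =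
        (φ₀.extend (𝓡∂ (n + 1))).symm (φ₀.extend (𝓡∂ (n + 1)) p + footModel n 1 (F₂ p - a) (ε / 5) w)
      rw [hDext p]
      have hsub : (D.chart.extend (𝓡∂ (n + 1))).source ⊆ (φ₀.extend (𝓡∂ (n + 1))).source := by
        rw [OpenPartialHomeomorph.extend_source, OpenPartialHomeomorph.extend_source, hDsrc]; exact inter_subset_left
      refine MorseChartReflect.symm_eq_symm_of_forall_eq hDext hsub ?_ ?_
      · exact hball3 (by rw [mem_closedBall, hDext p]; exact (mem_ball.1 hu).le)
      · exact hball5 ((ball_subset_closedBall.trans (closedBall_subset_closedBall (by linarith))) hu)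
    refine Iff.trans (C.footChar_iff_raw o) ?_
    have T₀ : HandleChart.TransferData (HandleChart.ofEqOn (X := handlePullback (J := 𝓡∂ (n + 1)) φ₀ p 1 (show (0 : ℝ) < ε / 10 by linarith))
        φ₀ hφ₀ hpφ₀ 1 (show (0 : ℝ) < ε / 10 by linarith) hfq (fun _ _ => rfl)) ε (F₂ p - a) :=
      ⟨(closedBall_subset_closedBall (by linarith)).trans hball5, hF₂.isMorse.contMDiff,
        hF₂.isInteriorPoint_of_le_lt_one (by rw [hFp, hadef]; have := pow_pos hεpos 2; linarith),
        not_isMCriticalPt_of_level hreg₂ hFp (by rw [hFp, hadef]; have := pow_pos hεpos 2; linarith)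
          (ne_of_lt (by rw [hFp, hadef]; have := pow_pos hεpos 2; linarith)),
        rfl, rfl, by rw [hFp, hadef]; have := pow_pos hεpos 2; linarith, hn1, hεpos⟩
    have hfl := HandleChart.TransferData.footLift_eq_of_foot_eq C.T T₀ C.ρ_pos C.hmR hmR (one_pow 2) (one_pow 2) hfeet
    constructor
    · intro h; have h' := h.1; rw [hfl] at h'; exact ⟨h'⟩
    · intro h; refine ⟨?_⟩; rw [hfl]; exact h.1
  · -- `FootChar'`: the feet of `D'` are the feet of `φ'`, hence of `φ₁` with the sign `s₀`
    have hm : (0 : ℝ) ≤ f₂ p' - a' := by rw [hfp', ha'def]; have := pow_pos hεpos 2; linarith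
    have hρ : (0 : ℝ) < ε / 5 := by linarith
    have hmR : f₂ p' - a' + 2 * (ε / 5) ^ 2 ≤ ε ^ 2 := by rw [hfp', ha'def]; nlinarith
    have hfeet : ∀ w : 𝔼 n, D'.foot 1 (f₂ p' - a') (ε / 5) w =
        (HandleChart.ofEqOn (X := handlePullback (J := 𝓡∂ (n + 1)) φ₁ p' 1 (show (0 : ℝ) < ε / 10 by linarith)) φ₁ hφ₁ hpφ₁ 1
          (show (0 : ℝ) < ε / 10 by linarith) hfq₁ (fun _ _ => rfl)).foot s₀ (f₂ p' - a') (ε / 5) w := by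
      intro w
      have hnorm : ‖footModel n 1 (f₂ p' - a') (ε / 5) w‖ < ε := norm_footModel_lt (one_pow 2) hm hρ hεpos hmR w
      have hu : φ'.extend (𝓡∂ (n + 1)) p' + footModel n 1 (f₂ p' - a') (ε / 5) w ∈ ball (φ'.extend (𝓡∂ (n + 1)) p') (3 * ε) := by
        rw [mem_ball, dist_eq_norm, add_sub_cancel_left]; linarith
      show (D'.chart.extend (𝓡∂ (n + 1))).symm (D'.chart.extend (𝓡∂ (n + 1)) p' + footModel n 1 (f₂ p' - a') (ε / 5) w) =
        (φ₁.extend (𝓡∂ (n + 1))).symm (φ₁.extend (𝓡∂ (n + 1)) p' + footModel n s₀ (f₂ p' - a') (ε / 5) w)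
      rw [hDext' p', ← hfeetφ' w]
      have hsub : (D'.chart.extend (𝓡∂ (n + 1))).source ⊆ (φ'.extend (𝓡∂ (n + 1))).source := by
        rw [OpenPartialHomeomorph.extend_source, OpenPartialHomeomorph.extend_source, hDsrc']; exact inter_subset_left
      refine MorseChartReflect.symm_eq_symm_of_forall_eq hDext' hsub ?_ ?_
      · exact hball3' (by rw [mem_closedBall, hDext' p']; exact (mem_ball.1 hu).le)
      · exact hball5' ((ball_subset_closedBall.trans (closedBall_subset_closedBall (by linarith))) hu)
    refine Iff.trans (C.footChar'_iff_raw o) ?_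
    have T₀' : HandleChart.TransferData (HandleChart.ofEqOn (X := handlePullback (J := 𝓡∂ (n + 1)) φ₁ p' 1 (show (0 : ℝ) < ε / 10 by linarith))
        φ₁ hφ₁ hpφ₁ 1 (show (0 : ℝ) < ε / 10 by linarith) hfq₁ (fun _ _ => rfl)) ε (f₂ p' - a') :=
      ⟨(closedBall_subset_closedBall (by linarith)).trans hball5₁, hf₂.isMorse.contMDiff,
        hf₂.isInteriorPoint_of_le_lt_one (by rw [hfp', ha'def]; have := pow_pos hεpos 2; linarith),
        not_isMCriticalPt_of_level hreg₂' hfp' (by rw [hfp', ha'def]; have := pow_pos hεpos 2; linarith)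
          (ne_of_lt (by rw [hfp', ha'def]; have := pow_pos hεpos 2; linarith)),
        rfl, rfl, by rw [hfp', ha'def]; have := pow_pos hεpos 2; linarith, hn1, hεpos⟩
    have hfl := HandleChart.TransferData.footLift_eq_of_foot_eq C.T' T₀' C.ρ_pos C.hmR' hmR (one_pow 2) hs₀ hfeet
    constructor
    · intro h; have h' := h.1; rw [hfl] at h'; exact ⟨h'⟩
    · intro h; refine ⟨?_⟩; rw [hfl]; exact h.1
  · -- the foot level of `M'` is connected
    exact C.connectedSpace_levelFoot'

end Data

end Literature.Topology.FourManifolds
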